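import Literature.NumberTheory.EllipticCurves.FineSelmerRankEqualityRoad
import Literature.NumberTheory.SerreUniformity.SplitCartan
import HarnessLib

/-!
# Statement (A) of Coates–Sujatha at `(E, 5)` for an image in the normaliser of a split Cartan subgroup `C_s⁺(5)`
# FROM THE LAYER-0 RANK EQUALITY `rank_5 Cl(ℚ(P)) = rank_5 Cl(ℚ(x(P)))` (degrees `8` and `4`)

Topic `NumberTheory/EllipticCurves` (grouping sub-namespace `CoatesSujatha2005.RankEqualityRoad`).  THEOREM-ONLY (no definition, no named fact, no
`sorry`); prover seat `bsd-potss-k8t-c4` g26 (cell `bsd-potss`, `--supports stmt-BirchSwinnertonDyer-19982`; closes nothing; neither BSD nor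
Conjecture A is booked for any curve).

`E/ℚ` with `Γ_ℚ` acting on `E[5]` in a basis `e` through `C_s⁺(5)` (`he`: diagonal or antidiagonal matrices), with elements `σ_u ↦ diag(2,1)`,
`σ_v ↦ diag(1,2)`, `σ_w ↦ (0 1; 1 0)` (the tree's `splitCartanBasis_five` data of the `μ`-road, conjA-anchor g11 / k8t-c4 g24).  Put `σ_m = σ_u²σ_v²`
(acting as `−1`), `H = ⟨σ̄_v⟩ = Stab(P)` for `P = e⁻¹(1,0)` (`L^H = ℚ(P)`, degree `8` when the image is all of `C_s⁺(5)`), `H′ = ⟨σ̄_m⟩H`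
(`L^{H′} = ℚ(x(P))`, degree `4`).  THEN the image-agnostic rank-equality road (`conjA_of_rankEq`, k8t-c4 g25) applies verbatim:

* `conjA_five_of_splitCartanBasis_of_rankEq` — `#Cl(ℚ(P))[5] = #Cl(ℚ(x(P)))[5]` (`hrank`, two CERTIFIABLE class numbers of degree-`8`/`4` fields) and
  `σ̄_m ∈ I(𝔮)` for every prime `𝔮 ∋ 5` of `ℚ(E[5])` (`hcI`) ⟹ statement (A) at `(E, 5)` for every cyclotomic `ℤ_5`-extension.  NO classical-`μ`
  hypothesis (the `μ`-road door `fineSelmerDual_moduleFinite_of_splitCartanBasis_five_abelian` displays six), no growth theorem, no named fact;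
  (c1) `5 ∤ #Gal(ℚ(E[5])/ℚ)` is automatic (orders in `C_s⁺(5)` divide `8`).

`hcI` stays DISPLAYED here: the finite criterion of `FineSelmerRankEqualityRoadInertia` («every image element of determinant `u` has a power `= −1`»)
FAILS for the full `C_s⁺(5)` (`diag(1,2)`); for additive potentially supersingular rows it holds by the structure of tame inertia (Serre 1972 §1), which
the tree does not have — per row it is a ramification datum of `ℚ(E[5])/ℚ(x(E[5]))` above `5`.

## References

* J. Coates, R. Sujatha, *Fine Selmer groups of elliptic curves over p-adic Lie extensions*, Math. Ann. 331 (2005), §3 Thm. 3.4, Lemma 3.8. [CoatesSujatha2005]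
* K. Iwasawa, *A note on class numbers of algebraic number fields*, Abh. Math. Sem. Hamburg 20 (1956), §§3–5. [Iwasawa1956]
* J.-P. Serre, *Propriétés galoisiennes des points d'ordre fini des courbes elliptiques*, Invent. Math. 15 (1972), §2.2, §1.11. [Serre1972]
* Yu. Bilu, P. Parent, M. Rebolledo, *Rational points on `X₀⁺(p^r)`*, Ann. Inst. Fourier 63 (2013), §1. [BiluParentRebolledo2013]
-/

set_option autoImplicit false

noncomputable section

open scoped Classical NumberField Matrix
open WeierstrassCurve Field IntermediateField
  Literature.NumberTheory.GaloisRepresentations Literature.NumberTheory.SerreUniformity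
  Literature.NumberTheory.IwasawaTheory Literature.NumberTheory.NumberFields

namespace Literature.NumberTheory.EllipticCurves.CoatesSujatha2005

namespace RankEqualityRoad

/-! ### §0 Finite facts about `C_s⁺(5)` and helpers -/

/-- An element of `splitCartanNormalizer 5` is `(a 0; 0 d)` with `ad ≠ 0` or `(0 b; c 0)` with `bc ≠ 0`. [folklore] -/
private theorem shape_of_mem_splitCartanNormalizer₆ {M : Matrix (Fin 2) (Fin 2) (ZMod 5)}
    (hM : M ∈ splitCartanNormalizer 5) :
    (∃ a d : ZMod 5, a * d ≠ 0 ∧ M = !![a, 0; 0, d]) ∨ (∃ b c : ZMod 5, b * c ≠ 0 ∧ M = !![0, b; c, 0]) := by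
  obtain ⟨hdet, h | h⟩ := hM
  · refine Or.inl ⟨M 0 0, M 1 1, ?_, ?_⟩
    · simpa only [Matrix.det_fin_two, h.1, h.2, mul_zero, sub_zero] using hdet
    · exact Matrix.ext fun i j => by fin_cases i <;> fin_cases j <;> simp [h.1, h.2]
  · refine Or.inr ⟨M 0 1, M 1 0, ?_, ?_⟩
    · have h' : -(M 0 1 * M 1 0) ≠ 0 := by
        simpa only [Matrix.det_fin_two, h.1, h.2, zero_mul, zero_sub] using hdet
      exact neg_ne_zero.mp h'
    · exact Matrix.ext fun i j => by fin_cases i <;> fin_cases j <;> simp [h.1, h.2]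

/-- Orders in `C_s⁺(5)` divide `8`: diagonal. [folklore] -/
private theorem d_pow_eight₆ : ∀ a d : ZMod 5, a * d ≠ 0 → (!![a, 0; 0, d] : Matrix (Fin 2) (Fin 2) (ZMod 5)) ^ 8 = 1 := by
  decide

/-- Orders in `C_s⁺(5)` divide `8`: antidiagonal. [folklore] -/
private theorem a_pow_eight₆ : ∀ b c : ZMod 5, b * c ≠ 0 → (!![0, b; c, 0] : Matrix (Fin 2) (Fin 2) (ZMod 5)) ^ 8 = 1 := by
  decide

/-- Every element of `C_s⁺(5)` has order dividing `8`. [folklore] -/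
private theorem pow_eight_eq_one_of_mem₆ {A : Matrix (Fin 2) (Fin 2) (ZMod 5)} (hA : A ∈ splitCartanNormalizer 5) : A ^ 8 = 1 := by
  rcases shape_of_mem_splitCartanNormalizer₆ hA with ⟨a, d, had, rfl⟩ | ⟨b, c, hbc, rfl⟩
  exacts [d_pow_eight₆ a d had, a_pow_eight₆ b c hbc]

/-- `diag(2,1)² · diag(1,2)² = −1` in `GL₂(𝔽₅)`. [folklore] -/
private theorem uuvv_eq_neg_one₆ :
    (!![2, 0; 0, 1] : Matrix (Fin 2) (Fin 2) (ZMod 5)) * !![2, 0; 0, 1] * !![1, 0; 0, 2] * !![1, 0; 0, 2] = -1 := by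
  decide

/-- Two matrices acting alike on all `e P` coincide (`e` onto). [folklore] -/
private theorem matrix_eq_of_forall_mulVec₆ {A : Type*} [AddCommGroup A] {n : ℕ} (e : A ≃+ (Fin 2 → ZMod n))
    {M N : Matrix (Fin 2) (Fin 2) (ZMod n)} (h : ∀ P : A, M *ᵥ e P = N *ᵥ e P) : M = N := by
  have h' : ∀ v, M *ᵥ v = N *ᵥ v := fun v => by simpa using h (e.symm v)
  ext i j
  have := congrFun (h' (Pi.single j 1)) i
  simpa [Matrix.mulVec_single] using this

/-- Restriction `Γ_F → Gal(E/F)` is onto. [folklore] -/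
private theorem absRestrictNormalHom_surjective₆ {F : Type} [Field F] (E : IntermediateField F (AlgebraicClosure F))
    [Normal F E] : Function.Surjective (absRestrictNormalHom E) := fun g => by
  obtain ⟨σ, hσ⟩ := AlgEquiv.restrictNormalHom_surjective (AlgebraicClosure F) g
  exact ⟨(Field.absoluteGaloisGroup.toAlgEquiv F).symm σ, hσ⟩

/-- `p ∤ #Gal(L/k)` when every element has order dividing `8` and `p ∤ 8`. [folklore] -/
private theorem not_dvd_card_of_forall_pow_eight₆ {k : Type} [Field k] (L : IntermediateField k (AlgebraicClosure k))
    [FiniteDimensional k L] {p : ℕ} (hp : p.Prime) (hp8 : ¬ p ∣ 8)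
    (h8 : ∀ g : L ≃ₐ[k] L, g ^ 8 = 1) : ¬ p ∣ Nat.card (L ≃ₐ[k] L) := by
  classical
  haveI : Fact p.Prime := ⟨hp⟩
  intro h5
  rw [Nat.card_eq_fintype_card] at h5
  obtain ⟨g, hg⟩ := exists_prime_orderOf_dvd_card p h5
  have h1 : orderOf g ∣ 8 := orderOf_dvd_of_pow_eq_one (h8 g)
  rw [hg] at h1
  exact hp8 h1

/-- **`5 ∤ #Gal(ℚ(E[5])/ℚ)` for an image in `C_s⁺(5)`.** [cite: Serre1972, §2.2] -/
theorem not_five_dvd_card_gal_of_splitCartanNormalizer (W : WeierstrassCurve ℚ) [W.IsElliptic]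
    (e : W.geomTorsion (5 : ℕ) ≃+ (Fin 2 → ZMod 5))
    (he : ∀ σ : absoluteGaloisGroup ℚ, ∃ M ∈ splitCartanNormalizer 5, ∀ P : W.geomTorsion (5 : ℕ), e (σ • P) = M *ᵥ e P) :
    ¬ 5 ∣ Nat.card (↥(W.divisionField 5) ≃ₐ[ℚ] ↥(W.divisionField 5)) := by
  haveI : Fact (Nat.Prime 5) := ⟨by norm_num⟩
  obtain ⟨ρm, hρm, hρme⟩ := exists_matrixRep_divisionField W 5 e
  have hmat : ∀ (σ : absoluteGaloisGroup ℚ) (M : Matrix (Fin 2) (Fin 2) (ZMod 5)),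
      (∀ P, e (σ • P) = M *ᵥ e P) → ρm (absRestrictNormalHom _ σ) = M :=
    fun σ M hM => matrix_eq_of_forall_mulVec₆ e fun P => by rw [← hρme, hM]
  have hπ := absRestrictNormalHom_surjective₆ (W.divisionField 5)
  refine not_dvd_card_of_forall_pow_eight₆ (W.divisionField 5) (p := 5) (by norm_num) (by norm_num) fun g => hρm ?_
  obtain ⟨σ, rfl⟩ := hπ g
  obtain ⟨M, hM, hMe⟩ := he σ
  rw [map_pow, map_one, hmat σ M hMe]
  exact pow_eight_eq_one_of_mem₆ hM

/-! ### §1 Statement (A) at `(E, 5)` for a `C_s⁺(5)` image from the rank equality -/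

/-- **(A) at `(E, 5)` for an image in `C_s⁺(5)` FROM THE RANK EQUALITY — no `μ`-hypothesis, no named fact.**  `E/ℚ` elliptic with `Γ_ℚ` acting on
`E[5]` through `C_s⁺(5)` in the basis `e` with `σ_u ↦ diag(2,1)`, `σ_v ↦ diag(1,2)`, `σ_w ↦ (0 1; 1 0)`; `σ_m := σ_u²σ_v²` acts as `−1`.  If
`#Cl(ℚ(E[5])^⟨σ̄_v⟩)[5] = #Cl(ℚ(E[5])^⟨σ̄_m, σ̄_v⟩)[5]` (`hrank`: `ℚ(P)` of degree `8` vs `ℚ(x(P))` of degree `4` for the full normaliser) and `σ̄_m ∈ I(𝔮)` for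
every prime `𝔮 ∋ 5` of `ℚ(E[5])` (`hcI`), then the dual fine Selmer group of `E` over `ℚ_cyc` is finitely generated over `ℤ_5` for every cyclotomic
`ℤ_5`-extension (`conjA_of_rankEq` with `S = diag(1,2)`, `X = (0 1; 1 0)`; (c1) by `not_five_dvd_card_gal_of_splitCartanNormalizer`).
[cite: CoatesSujatha2005, §3 Thm. 3.4 and Lemma 3.8] [cite: Iwasawa1956, §§3–5] [cite: Serre1972, §2.2] -/
theorem conjA_five_of_splitCartanBasis_of_rankEq (W : WeierstrassCurve ℚ) [W.IsElliptic]
    (e : W.geomTorsion (5 : ℕ) ≃+ (Fin 2 → ZMod 5))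
    (he : ∀ σ : absoluteGaloisGroup ℚ, ∃ M ∈ splitCartanNormalizer 5, ∀ P : W.geomTorsion (5 : ℕ), e (σ • P) = M *ᵥ e P)
    (σu σv σw : absoluteGaloisGroup ℚ) (hσu : ∀ P : W.geomTorsion (5 : ℕ), e (σu • P) = !![2, 0; 0, 1] *ᵥ e P)
    (hσv : ∀ P : W.geomTorsion (5 : ℕ), e (σv • P) = !![1, 0; 0, 2] *ᵥ e P)
    (hσw : ∀ P : W.geomTorsion (5 : ℕ), e (σw • P) = !![0, 1; 1, 0] *ᵥ e P)
    (hrank : Nat.card {d : ClassGroup (𝓞 ↥(fixedField (Subgroup.zpowers (absRestrictNormalHom (W.divisionField 5) σv)))) // d ^ 5 = 1} =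
      Nat.card {d : ClassGroup (𝓞 ↥(fixedField (Subgroup.zpowers (absRestrictNormalHom (W.divisionField 5) (σu * σu * (σv * σv))) ⊔
        Subgroup.zpowers (absRestrictNormalHom (W.divisionField 5) σv)))) // d ^ 5 = 1})
    (hcI : ∀ (𝔮 : Ideal (𝓞 ↥(W.divisionField 5))) [𝔮.IsMaximal], ((5 : ℕ) : 𝓞 ↥(W.divisionField 5)) ∈ 𝔮 →
      absRestrictNormalHom (W.divisionField 5) (σu * σu * (σv * σv)) ∈ 𝔮.inertia _)
    (κ : ZpExtension ℚ 5) (hκ : κ.IsCyclotomic) :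
    ∃ (γ : absoluteGaloisGroup ℚ) (D : W.FineSelmerDualData κ γ),
      Module.Finite ℤ_[5] (RestrictScalars ℤ_[5] (IwasawaAlgebra 5) D.X) := by
  haveI : Fact (Nat.Prime 5) := ⟨by norm_num⟩
  have hσm : ∀ P : W.geomTorsion (5 : ℕ), e ((σu * σu * (σv * σv)) • P) = -e P := fun P => by
    rw [mul_smul, mul_smul, mul_smul, hσu, hσu, hσv, hσv, Matrix.mulVec_mulVec, Matrix.mulVec_mulVec, Matrix.mulVec_mulVec,
      uuvv_eq_neg_one₆, Matrix.neg_mulVec, Matrix.one_mulVec]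
  exact conjA_of_rankEq W (by norm_num) (not_five_dvd_card_gal_of_splitCartanNormalizer W e he) e σv (σu * σu * (σv * σv)) σw
    (S := !![1, 0; 0, 2]) (by simp) (by simp) hσv hσm (X := !![0, 1; 1, 0]) (by simp) hσw hrank hcI κ hκ

end RankEqualityRoad

end Literature.NumberTheory.EllipticCurves.CoatesSujatha2005

end
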